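import Literature.MathematicalPhysics.QuantumFieldTheory.Balaban1983to89.B11Eq90CurrentAtLetters
import Literature.MathematicalPhysics.QuantumFieldTheory.Balaban1983to89.B11Eq80CurrentZpow

/-!
# `Balaban1983to89.B11Eq90CurrentAtLettersZpow` — T. Bałaban, *The variational problem and background fields in renormalization group method for lattice gauge theories*, Commun. Math. Phys. **102** (1985) 277–309 [Balaban1985Variational]: (63) p. 287, (80) p. 290, (84) p. 290 — THE (63) CERTIFICATE «`W = (δ/δA′)V`» AT THE CHAIN'S LETTERS `J := Jcur U`, `Δπ := deltaPiCLM …` WITH THE PRINTED WEIGHT `η^{d−4}` OF (5) AS AN INTEGER POWER — every dimension `d`, in particular `d = 3`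

statement-level skeleton of published theorems with citation tags; proofs where landed; nothing here is a claim about the Yang–Mills mass gap

PDF held: `paper:balaban1985-cmp102-variational-background` (journal page = PDF page + 276); the displays (63) p. 287, (80) p. 290, (84)–(90)
pp. 290–291 are transcribed verbatim in the module docstrings of `B11Eq80Current` and `B11Eq90V0primeCurrent` and are not repeated.

CITATION HEADER (lean-in-tree rule 2026-08-18).  WHAT IS REPRODUCED: the `d`-dependent member of `B11Eq90CurrentAtLetters` §1 — the (63)
certificate `pair27_W80L (hd : 4 ≤ d)` at the letters `J := B11Eq98CurrentSlot.Jcur U`, `Δπ := B9Eq3119DeltaPiCarrier.deltaPiCLM …` — ON THE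
INTEGER-POWER ACTION CARRIER, as the LETTERS LAYER over `B11Eq80CurrentZpow` (seat ym3-torus-px19 g2: `V80Z`, `pair27_W80_zpow`, every `d`).
THE LOCATED SCOPE DEFECT (cell `ym3-torus`, rung R3 = `d = 3`; EX namer ym-ust-19200-w2 g6 2026-08-28T19:24:27Z seam (a) / (G16);
LOCATE `ym3-torus-px14/LOCATE-W80-63-D3-px14g2.md`, `ym3-torus-px19` 19:26:44Z): `B9Eq39Adjoint.action` types the weight `η^{d−4}` of (5) with
the natural-number subtraction `d - 4`, so (30) `eq30a`, hence `bondPair_curV0`, `pair27_curV0full`, `pair27_W80` and `pair27_W80L` carry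
`4 ≤ d` — EMPTY at `d = 3`; the upstream cure (`B9Eq31ActionZpow`, `B11Eq26ExpansionZpow`; recipe `INTERFACES-r06.md` §36b) is propagated to
(80)/(63) by `B11Eq80CurrentZpow`, and THIS FILE is the last link, at the letters (nothing of `B11Eq90CurrentAtLetters` is modified — twin):
* §1 **`V80LZ`** — `V(A′)` of (80) at the letters on the integer-power action (`B11Eq80CurrentZpow.V80Z` at `Jcur U`, `deltaPiCLM …`); the
  bridge **`V80LZ_eq_V80L (hd : 4 ≤ d)`**; ★ **`pair27_W80L_zpow`** — `⟨W80L(A′), δ⟩ = (d/dt) V80LZ(A′ + tδ)|_{t=0}` on `‖A′‖ < a_C`, NO `4 ≤ d`,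
  the symmetry row `hΔ` DISCHARGED by `deltaPiCLM_pair27_comm` (tracial `τ`, the cell's norming `⟪φ⁻¹X, φ⁻¹Y⟫ = τ(X*Y)`, unitary `U`).
* §2 sanity at `d = 3` (an `example`: the letters certificate is not vacuous on rung R3's dimension).

DICTIONARY.  As in `B11Eq90CurrentAtLetters` (nothing re-declared): the fine torus `fineP Lt m` of `B9Eq319QprimeTorus`, unitary background
`U`, the cell's Hilbert fibre `φ : W ≃ₗ[ℂ] 𝔸` with `⟪φ⁻¹X, φ⁻¹Y⟫ = τ(X*Y)`, `G′ ↦ Gp`, the space (115) `Space115 L η lev₀ lev₁ Dc`, currents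
`NegSize L η lev₀ 3 𝔸`, pairing (27) `pair27 τ`, `W80L`/`V80L` of `B11Eq90CurrentAtLetters`, `V80Z` of `B11Eq80CurrentZpow`.

HONEST SCOPE — what is NOT claimed.  (i) No estimate ((98) stays displayed where it is); (ii) `W80L` is an UNCHANGED object — only the reference
functional is re-based on `actionZ`; for `4 ≤ d` everything here IS the old statement (`V80LZ_eq_V80L`); (iii) `ρ`, `τ`, `H`, `C`, `ε_C`, `G′`
remain letters; (iv) NOT summit progress: rung R3 (YM₃ on T³) bookkeeping for the cell `ym3-torus` (stmt-QuantumFields-19200, EX display seam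
(a)), not `d = 4`, not Clay; YM gap NOT proved.  Seat `ym3-torus-px14` (gen 2, width hand; (G16)(i)).  Imports `B11Eq90CurrentAtLetters`,
`B11Eq80CurrentZpow` ONLY; modifies nothing.
-/

noncomputable section

open NormedSpace Complex Metric Set Finset Filter Topology
open scoped InnerProductSpace

namespace Literature.MathematicalPhysics.QuantumFieldTheory.Balaban1983to89.B11Eq90CurrentAtLettersZpow

open Literature.MathematicalPhysics.QuantumFieldTheory.Balaban1983to89.B11Prop6Scheme (Prop4Hyp)
open Literature.MathematicalPhysics.QuantumFieldTheory.Balaban1983to89.B11Eq174Chart (Regime)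
open Literature.MathematicalPhysics.QuantumFieldTheory.Balaban1983to89.B11Eq90V0primeCurrent (flat115)
open Literature.MathematicalPhysics.QuantumFieldTheory.Balaban1983to89.B11Eq90Transpose (pair27)
open Literature.MathematicalPhysics.QuantumFieldTheory.Balaban1983to89.B11Eq80Current (W80 V80)
open Literature.MathematicalPhysics.QuantumFieldTheory.Balaban1983to89.B11Eq80CurrentZpow (V80Z V80Z_eq_V80 pair27_W80_zpow)
open Literature.MathematicalPhysics.QuantumFieldTheory.Balaban1983to89.B11Eq90CurrentAtLetters (V80L W80L)
open Literature.MathematicalPhysics.QuantumFieldTheory.Balaban1983to89.B11Eq98CurrentSlot (Jcur)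
open Literature.MathematicalPhysics.QuantumFieldTheory.Balaban1983to89.B9Eq3119DeltaPiCarrier (deltaPiCLM deltaPiCLM_pair27_comm)
open B9SectCLatticeCarrier (Bond)
open B9Eq319QprimeTorus (fineP)
open B11Eq103H1Complex (SiteL2K)
open B11Eq115Space

variable {d : ℕ} (Lt : ℕ) [NeZero Lt] (m : Fin d → ℕ) {𝔸 : Type*} [NormedRing 𝔸] [NormedAlgebra ℂ 𝔸] [StarRing 𝔸] [StarModule ℂ 𝔸]
  [FiniteDimensional ℂ 𝔸] [CompleteSpace 𝔸] {W : Type*} [NormedAddCommGroup W] [InnerProductSpace ℂ W] [FiniteDimensional ℂ W]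
  (φ : W ≃ₗ[ℂ] 𝔸) {c₀ : ℝ} [Fact (0 < c₀)] {L η : ℝ} [Fact (0 < L)] [Fact (0 < η)] (U : Bond d (fineP Lt m) → 𝔸ˣ)
  (Gp : SiteL2K ℂ d (fineP Lt m) c₀ W →ₗ[ℂ] SiteL2K ℂ d (fineP Lt m) c₀ W)
  {lev₀ : Bond d (fineP Lt m) → ℕ} {κ' : Type*} [Fintype κ'] (lev₁ : κ' → ℕ) (Dc : (Bond d (fineP Lt m) → 𝔸) →ₗ[ℂ] (κ' → 𝔸))
  {𝒳 : Type*} [NormedAddCommGroup 𝒳] [NormedSpace ℂ 𝒳]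

/-! ## §1 `V` of (80) at the letters on the integer-power action, and the (63) certificate for `W80L`, every `d` -/

/-- **`V(A′)` OF (80) AT THE CHAIN'S LETTERS, INTEGER-POWER ACTION**: `B11Eq80CurrentZpow.V80Z` with `J := B11Eq98CurrentSlot.Jcur U` and
`Δπ := B9Eq3119DeltaPiCarrier.deltaPiCLM Lt m φ τ U G′ lev₁ Dc` — the twin of `B11Eq90CurrentAtLetters.V80L` (`V80 ↦ V80Z`), so that it is
print's (80) in EVERY dimension (at `d = 3`: `η^{d−4} = η⁻¹`). [cite: Balaban1985Variational, (80) p.290, (26) p.282, (5) p.278] -/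
def V80LZ (ρ' : 𝔸 →L[ℂ] ℂ) (H : 𝒳 →L[ℂ] Space115 L η lev₀ lev₁ Dc) (C : Space115 L η lev₀ lev₁ Dc → 𝒳) (εC : ℝ)
    (A' : Space115 L η lev₀ lev₁ Dc) : ℂ :=
  V80Z ρ' U H C εC (Jcur (L := L) (η := η) (lev₀ := lev₀) U) (deltaPiCLM Lt m φ (ρ' : 𝔸 →ₗ[ℂ] ℂ) U Gp lev₁ Dc) A'

/-- **BRIDGE AT THE LETTERS**: for `4 ≤ d`, `V80LZ = B11Eq90CurrentAtLetters.V80L` (`B11Eq80CurrentZpow.V80Z_eq_V80`) — nothing changes for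
the dimensions the old certificate covers. [cite: Balaban1985Variational, (80) p.290] -/
theorem V80LZ_eq_V80L (hd : 4 ≤ d) (ρ' : 𝔸 →L[ℂ] ℂ) (H : 𝒳 →L[ℂ] Space115 L η lev₀ lev₁ Dc)
    (C : Space115 L η lev₀ lev₁ Dc → 𝒳) (εC : ℝ) (A' : Space115 L η lev₀ lev₁ Dc) :
    V80LZ Lt m φ U Gp lev₁ Dc ρ' H C εC A' = V80L Lt m φ U Gp lev₁ Dc ρ' H C εC A' := by
  simp only [V80LZ, V80L, V80Z_eq_V80 hd]

variable {H : 𝒳 →L[ℂ] Space115 L η lev₀ lev₁ Dc} {C : Space115 L η lev₀ lev₁ Dc → 𝒳} {b C₂ c₄ aC εC : ℝ}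

/-- ★ **THE (63) CERTIFICATE AT THE LETTERS, EVERY `d`, `hΔ` DISCHARGED** by `deltaPiCLM_pair27_comm` (tracial `τ`, the cell's norming
`⟪φ⁻¹X, φ⁻¹Y⟫ = τ(X*Y)`, unitary `U`): on `‖A′‖ < a_C` (Sect. C regime, `C` of Prop.-4 type), with the dualising identity `τ(ρ(ℓ)X) = ℓ X`,
`⟨W80L(A′), δ⟩ = (d/dt) V80LZ(A′ + tδ)|_{t=0}` — `W80L` (unchanged object) IS `(δ/δA′)V` at the letters in EVERY dimension (`d = 3` included);
the twin of `B11Eq90CurrentAtLetters.pair27_W80L` WITHOUT `4 ≤ d` (`B11Eq80CurrentZpow.pair27_W80_zpow` at the letters).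
[cite: Balaban1985Variational, (63) p.287, (84) p.290, (80) p.290] -/
theorem pair27_W80L_zpow [CompleteSpace 𝒳] {ρ : (𝔸 →L[ℂ] ℂ) →L[ℂ] 𝔸} {τ : 𝔸 →L[ℂ] ℂ}
    (hρ : ∀ (ℓ : 𝔸 →L[ℂ] ℂ) (X : 𝔸), τ (ρ ℓ * X) = ℓ X) (hτ : ∀ a b : 𝔸, τ (a * b) = τ (b * a))
    (hφ : ∀ X Y : 𝔸, ⟪φ.symm X, φ.symm Y⟫_ℂ = τ (star X * Y)) (hU : ∀ b, star (U b : 𝔸) = ((U b)⁻¹ : 𝔸ˣ))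
    (RC : Regime H 0 C b 0 C₂ c₄ 0 aC εC) (hC : Prop4Hyp C C₂ c₄) {A' : Space115 L η lev₀ lev₁ Dc} (hA' : ‖A'‖ < aC)
    (δ' : Space115 L η lev₀ lev₁ Dc) :
    pair27 τ (W80L Lt m φ U Gp lev₁ Dc ρ τ H C εC A') (flat115 δ')
      = deriv (fun t : ℂ => V80LZ Lt m φ U Gp lev₁ Dc τ H C εC (A' + t • δ')) 0 :=
  pair27_W80_zpow hρ hτ U RC hC _ (deltaPiCLM_pair27_comm Lt m φ U Gp lev₁ Dc τ hτ hφ hU) hA' δ'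

/-! ## §2 Sanity: the letters certificate is not vacuous at `d = 3` (rung R3's dimension) -/

/-- At `d = 3` (a fine torus `fineP Lt m3`, `m3 : Fin 3 → ℕ`): `⟨W80L(A′), δ⟩ = (d/dt)V80LZ(A′ + tδ)|₀` — an instance of `pair27_W80L_zpow` with NO
dimension hypothesis (the tree's `pair27_W80L` is empty here). [cite: Balaban1985Variational, (63) p.287, (84) p.290] -/
example (m3 : Fin 3 → ℕ) (U3 : Bond 3 (fineP Lt m3) → 𝔸ˣ) (Gp3 : SiteL2K ℂ 3 (fineP Lt m3) c₀ W →ₗ[ℂ] SiteL2K ℂ 3 (fineP Lt m3) c₀ W)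
    {lev3 : Bond 3 (fineP Lt m3) → ℕ} (Dc3 : (Bond 3 (fineP Lt m3) → 𝔸) →ₗ[ℂ] (κ' → 𝔸))
    {H3 : 𝒳 →L[ℂ] Space115 L η lev3 lev₁ Dc3} {C3 : Space115 L η lev3 lev₁ Dc3 → 𝒳} [CompleteSpace 𝒳]
    {ρ : (𝔸 →L[ℂ] ℂ) →L[ℂ] 𝔸} {τ : 𝔸 →L[ℂ] ℂ}
    (hρ : ∀ (ℓ : 𝔸 →L[ℂ] ℂ) (X : 𝔸), τ (ρ ℓ * X) = ℓ X) (hτ : ∀ a b : 𝔸, τ (a * b) = τ (b * a))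
    (hφ : ∀ X Y : 𝔸, ⟪φ.symm X, φ.symm Y⟫_ℂ = τ (star X * Y)) (hU : ∀ b, star (U3 b : 𝔸) = ((U3 b)⁻¹ : 𝔸ˣ))
    (RC : Regime H3 0 C3 b 0 C₂ c₄ 0 aC εC) (hC : Prop4Hyp C3 C₂ c₄) {A' : Space115 L η lev3 lev₁ Dc3} (hA' : ‖A'‖ < aC)
    (δ' : Space115 L η lev3 lev₁ Dc3) :
    pair27 τ (W80L Lt m3 φ U3 Gp3 lev₁ Dc3 ρ τ H3 C3 εC A') (flat115 δ')
      = deriv (fun t : ℂ => V80LZ Lt m3 φ U3 Gp3 lev₁ Dc3 τ H3 C3 εC (A' + t • δ')) 0 :=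
  pair27_W80L_zpow Lt m3 φ U3 Gp3 lev₁ Dc3 hρ hτ hφ hU RC hC hA' δ'

end Literature.MathematicalPhysics.QuantumFieldTheory.Balaban1983to89.B11Eq90CurrentAtLettersZpow

end
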